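import Mathlib
import Summits.Ventures.HodgeRepro2.T5IsotypicQuotAction
import Summits.Ventures.HodgeRepro2.T5HoweSmooth
import Summits.Ventures.HodgeRepro2.T5CornerAlgebra

/-!
# Howe uniqueness for `S[π₁]` itself: the composition

Blind cell `pub-hodge-repro2`, seat p8 (gen 6), Tier-5 kernel support for the N3 record
(§N3.12.4 (s1)–(s4) and N3.10.3; MVW chap. 2 III.3–III.5).  The kernel pieces of the chain —
`T5TensorSeparation` (p391188), `T5IsotypicProduct` (p392441), `T5SmoothPassage` (p393489),
`T5CornerAlgebra` (p393644), `T5IsotypicHom` (p392230), `T5SchurTensorEquivariance` (p392068),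
`T5HoweUniqueness` (p391018), `T5HoweSmooth` (p393752) and `T5IsotypicQuotAction` (p393840) —
composed into statements about the oscillator module `S` itself:

* `isSmoothModule_quotient` — a quotient of a smooth module is smooth;
* `exists_surjective_of_equivariant_isotypicQuot` — for `S[N]` semisimple (hypothesis), a
  non-zero `R`-linear `R₂`-equivariant `Φ : S → N ⊗[k] P` with `P` simple over `R₂` gives a
  surjective `R₂`-linear `t : Hom_R(N, S[N]) → P` with `Φ x = ` … `liftΦ Φ (f n) = n ⊗ t f`;
* `exists_surjective_of_equivariant_of_admissible` — the same with the semisimplicity of `S[N]`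
  DISCHARGED from smoothness of `S` for a family of idempotents `e i ∈ R` with `e i • N ≠ 0`
  finite-dimensional (admissibility of `N`);
* `nonempty_linearEquiv_of_unique_coatom_of_admissible` — **uniqueness of the partner of `N`
  in `S`**: if moreover `Hom_R(N, S[N])` has a unique maximal `R₂`-submodule (the printed
  «unique irreducible quotient», Howe 1989 Thm 2.1 / MVW III.4), any two simple `R₂`-modules
  `P`, `P₂` admitting non-zero equivariant maps `S → N ⊗ P`, `S → N ⊗ P₂` are isomorphic.

In the record: `R = H(G₁)⁺`, `R₂ = H(G₂)⁺` (or `k[G₂]`), `k = ℂ`, `S = ω` (the oscillator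
representation, smooth for `G₁ × G₂`), `N = π₁` irreducible admissible with `End = ℂ`
(p391867 / p392858), `e i = e_{K_i}` along small `K_i` with `π₁^{K_i} ≠ 0`.  What stays prose:
smooth representations = non-degenerate Hecke modules, `e_K • π = π^K`, and the printed theorems
(the unique quotient; Howe duality).  Nothing arithmetic is asserted.

README §8(d): uses an L-value-free non-vanishing device: NO.
-/

/- The descended `R₂`-module structure of `T5IsotypicQuotAction` would also be found for
`R₂ = k`, where Mathlib's `Submodule.Quotient.module'` is the intended `k`-structure of `S[N]`;
in this file it is re-registered with low priority so that `Module k (S ⧸ S(N))` is Mathlib's. -/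
attribute [-instance] Summit.Ventures.HodgeRepro2.T5IsotypicQuotAction.instModuleIsotypicQuot
attribute [local instance low] Summit.Ventures.HodgeRepro2.T5IsotypicQuotAction.instModuleIsotypicQuot

namespace Summit.Ventures.HodgeRepro2.T5HoweIsotypicQuot

open Summit.Ventures.HodgeRepro2
open Summit.Ventures.HodgeRepro2.T5IsotypicProduct
open Summit.Ventures.HodgeRepro2.T5SmoothPassage
open Summit.Ventures.HodgeRepro2.T5IsotypicQuotAction
open Summit.Ventures.HodgeRepro2.T5CornerSmooth

section Smooth

variable {R : Type*} [Ring R] {ι : Type*} (e : ι → R)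
  {S : Type*} [AddCommGroup S] [Module R S]

/-- A quotient of a smooth module is smooth. -/
theorem isSmoothModule_quotient (hs : IsSmoothModule e (M := S)) (p : Submodule R S) :
    IsSmoothModule e (M := S ⧸ p) := by
  intro x
  induction x using Submodule.Quotient.induction_on with
  | H z =>
    obtain ⟨i, hi⟩ := hs z
    exact ⟨i, by rw [← Submodule.Quotient.mk_smul, hi]⟩

end Smooth

section Main

variable {k R R₂ : Type*} [Field k] [Ring R] [Algebra k R] [Ring R₂] [Algebra k R₂]
  {N : Type*} [AddCommGroup N] [Module R N] [Module k N] [IsScalarTower k R N]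
  {S : Type*} [AddCommGroup S] [Module R S] [Module k S] [IsScalarTower k R S]
  [Module R₂ S] [SMulCommClass R₂ R S] [IsScalarTower k R₂ S]
  {P : Type*} [AddCommGroup P] [Module R₂ P] [Module k P] [IsScalarTower k R₂ P]

/-- **The partner is a quotient of `Hom_R(N, S[N])`** (semisimplicity of `S[N]` as hypothesis). -/
theorem exists_surjective_of_equivariant_isotypicQuot [IsSimpleModule R N]
    (hSchur : ∀ φ : N →ₗ[R] N, ∃ c : k, ∀ x, φ x = c • x)
    [IsSemisimpleModule R (S ⧸ isotypicKer R N S)] [IsSimpleModule R₂ P]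
    (Φ : S →ₗ[R] TensorProduct k N P) (hΦ : Φ ≠ 0)
    (hequiv : ∀ (r : R₂) (x : S),
      Φ (r • x) = TensorProduct.map LinearMap.id (DistribSMul.toLinearMap k P r) (Φ x)) :
    ∃ t : (N →ₗ[R] S ⧸ isotypicKer R N S) →ₗ[R₂] P, Function.Surjective t ∧
      ∀ (n : N) (f : N →ₗ[R] S ⧸ isotypicKer R N S), liftΦ Φ (f n) = n ⊗ₜ[k] t f :=
  T5HoweSmooth.exists_surjective_of_equivariant hSchur
    (isIsotypicOfType_of_separated (separated_isotypicQuot S)) (liftΦ Φ) (liftΦ_ne_zero hΦ)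
    (liftΦ_equivariant Φ (fun r => DistribSMul.toLinearMap k P r) hequiv)

variable {ι : Type*} (e : ι → R) (he : ∀ i, IsIdempotentElem (e i))

include he in
/-- **The partner is a quotient of `Hom_R(N, S[N])`, from admissibility**: `S` smooth for the
idempotents `e i`, `e i • N ≠ 0` finite-dimensional for every `i` (`N` admissible). -/
theorem exists_surjective_of_equivariant_of_admissible [IsSimpleModule R N]
    (hSchur : ∀ φ : N →ₗ[R] N, ∃ c : k, ∀ x, φ x = c • x)
    (hs : IsSmoothModule e (M := S)) (hN : ∀ i, ∃ n : N, e i • n ≠ 0)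
    [∀ i, FiniteDimensional k ↥(T5CornerSimple.cornerModule (e i) N)] [IsSimpleModule R₂ P]
    (Φ : S →ₗ[R] TensorProduct k N P) (hΦ : Φ ≠ 0)
    (hequiv : ∀ (r : R₂) (x : S),
      Φ (r • x) = TensorProduct.map LinearMap.id (DistribSMul.toLinearMap k P r) (Φ x)) :
    ∃ t : (N →ₗ[R] S ⧸ isotypicKer R N S) →ₗ[R₂] P, Function.Surjective t ∧
      ∀ (n : N) (f : N →ₗ[R] S ⧸ isotypicKer R N S), liftΦ Φ (f n) = n ⊗ₜ[k] t f :=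
  haveI : IsSemisimpleModule R (S ⧸ isotypicKer R N S) :=
    T5CornerAlgebra.isSemisimpleModule_of_isSmoothModule_of_finiteDimensional (k := k) e he
      (separated_isotypicQuot S) (isSmoothModule_quotient e hs _) hN
  exists_surjective_of_equivariant_isotypicQuot hSchur Φ hΦ hequiv

include he in
/-- **Uniqueness of the partner of `N` in `S`** (from admissibility + the printed unique
quotient of `Hom_R(N, S[N])`). -/
theorem nonempty_linearEquiv_of_unique_coatom_of_admissible [IsSimpleModule R N]
    (hSchur : ∀ φ : N →ₗ[R] N, ∃ c : k, ∀ x, φ x = c • x)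
    (hs : IsSmoothModule e (M := S)) (hN : ∀ i, ∃ n : N, e i • n ≠ 0)
    [∀ i, FiniteDimensional k ↥(T5CornerSimple.cornerModule (e i) N)]
    (hΘ : ∃! J : Submodule R₂ (N →ₗ[R] S ⧸ isotypicKer R N S), IsCoatom J)
    {P₂ : Type*} [AddCommGroup P₂] [Module R₂ P₂] [Module k P₂] [IsScalarTower k R₂ P₂]
    [IsSimpleModule R₂ P] [IsSimpleModule R₂ P₂]
    (Φ₁ : S →ₗ[R] TensorProduct k N P) (hΦ₁ : Φ₁ ≠ 0)
    (hequiv₁ : ∀ (r : R₂) (x : S),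
      Φ₁ (r • x) = TensorProduct.map LinearMap.id (DistribSMul.toLinearMap k P r) (Φ₁ x))
    (Φ₂ : S →ₗ[R] TensorProduct k N P₂) (hΦ₂ : Φ₂ ≠ 0)
    (hequiv₂ : ∀ (r : R₂) (x : S),
      Φ₂ (r • x) = TensorProduct.map LinearMap.id (DistribSMul.toLinearMap k P₂ r) (Φ₂ x)) :
    Nonempty (P ≃ₗ[R₂] P₂) := by
  obtain ⟨t₁, ht₁, -⟩ :=
    exists_surjective_of_equivariant_of_admissible e he hSchur hs hN Φ₁ hΦ₁ hequiv₁
  obtain ⟨t₂, ht₂, -⟩ :=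
    exists_surjective_of_equivariant_of_admissible e he hSchur hs hN Φ₂ hΦ₂ hequiv₂
  exact T5HoweUniqueness.simple_quotients_equiv hΘ t₁ t₂ ht₁ ht₂

end Main

end Summit.Ventures.HodgeRepro2.T5HoweIsotypicQuot
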